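import Summits.CriticalPhenomena.SAWScalingLimit.Theorems.SAWDevelopingMapObservableToSLETypeLadderCarvedReductionSqueezeConeExit
import Mathlib.Analysis.InnerProductSpace.Basic
import HarnessLib

/-!
# The exit cone of one gate stays a fixed distance off the other root, uniformly in the drift
# (piece (T-A′ P1-far) of stub T-A′ `stub_carvedReduction_squeezeGeometry_domains`)

Crux `SAWDevelopingMap.ObservableToSLE` (stmt-CriticalPhenomena-10472), line `six-class-type-ladder`,
stub T-A′ `stub_carvedReduction_squeezeGeometry_domains`.  Landing target:
`Summits/CriticalPhenomena/SAWScalingLimit/Theorems/SAWDevelopingMapObservableToSLETypeLadderCarvedReductionSqueezeConeFar.lean`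
(`--supports stmt-CriticalPhenomena-10472`; registered carrier `stub_carvedReduction_coneFar`).

Separation input (E6 of the worker log) for `stub_carvedReduction_superFrame`: the exit zone `F k`
of gate `k` (`stub_carvedReduction_exits`: inside `f '' {w | 1 ≤ re (w d̄ₖ), (1 - β)‖w‖ < re (w d̄ₖ)}`,
`f = H - τ`) must miss everything near the OTHER gate, which lies in a small ball about the pinned
root `D.pt i - τ = f (d i)`.  Since `H` is `D`'s own Schoenflies homeomorphism, the radius is
uniform in the drift `τ`: `stub_carvedReduction_coneFar` — for a homeomorphism `H`, unit directions
`d 0 ≠ d 1` and `β > 0` there is `ε > 0` (depending on `H, d, β` only) such that for every `τ`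
and `i ≠ k`, `(H - τ) '' {1 ≤ re (w d̄ₖ), (1 - β)‖w‖ ≤ re (w d̄ₖ)}` misses `ball (H (d i) - τ) ε`
(the closed cone is closed and does not contain `d i`, as `re (dᵢ d̄ₖ) < 1` for distinct unit
vectors; continuity of `H⁻¹` at `H (d i)`).
-/

noncomputable section
open scoped Topology ComplexConjugate
open Filter Set Metric Function
open Literature.Probability.RandomPlanarGeometry

namespace Summit.CriticalPhenomena.SAWScalingLimit.Theorems.ObservableToSLE.TypeLadder

/-- Distinct unit vectors have `re (d₀ d̄₁) < 1`. -/
theorem re_mul_conj_lt_one_of_ne {d₀ d₁ : ℂ} (h₀ : ‖d₀‖ = 1) (h₁ : ‖d₁‖ = 1) (hne : d₀ ≠ d₁) :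
    (d₀ * conj d₁).re < 1 := by
  -- `‖d₀ - d₁‖² = 2 - 2 re (d₀ d̄₁)`
  have hsq : ‖d₀ - d₁‖ ^ 2 = 2 - 2 * (d₀ * conj d₁).re := by
    rw [Complex.sq_norm, Complex.normSq_sub, Complex.normSq_eq_norm_sq, Complex.normSq_eq_norm_sq, h₀, h₁]
    ring
  have hpos : 0 < ‖d₀ - d₁‖ := norm_pos_iff.2 (sub_ne_zero.2 hne)
  nlinarith

/-- **Registered carrier `stub_carvedReduction_coneFar`** (crux item stmt-CriticalPhenomena-10472,
stub T-A′ `stub_carvedReduction_squeezeGeometry_domains`, piece THE EXIT CONE IS FAR FROM THE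
OTHER ROOT); see the module docstring. -/
theorem stub_carvedReduction_coneFar :
    ∀ (H : ℂ ≃ₜ ℂ) (d : Fin 2 → ℂ) (β : ℝ), (∀ i, ‖d i‖ = 1) → d 0 ≠ d 1 → 0 < β →
      ∃ ε > (0 : ℝ), ∀ (τ : ℂ) (i k : Fin 2), i ≠ k →
        Disjoint ((H.trans (Homeomorph.addRight (-τ))) ''
            {w : ℂ | 1 ≤ (w * conj (d k)).re ∧ (1 - β) * ‖w‖ ≤ (w * conj (d k)).re})
          (ball (H (d i) - τ) ε) := by
  intro H d β hdn hd01 hβ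
  set C : Fin 2 → Set ℂ := fun k => {w : ℂ | 1 ≤ (w * conj (d k)).re ∧ (1 - β) * ‖w‖ ≤ (w * conj (d k)).re} with hC
  have hL : ∀ k, Continuous fun w : ℂ => (w * conj (d k)).re := fun k =>
    Complex.continuous_re.comp (continuous_id.mul continuous_const)
  have hCcl : ∀ k, IsClosed (C k) := fun k =>
    (isClosed_le continuous_const (hL k)).inter (isClosed_le (continuous_const.mul continuous_norm) (hL k))
  have hdi : ∀ i k, i ≠ k → d i ∉ C k := by
    intro i k hik hmem
    have hne : d i ≠ d k := by
      fin_cases i <;> fin_cases k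
      · exact absurd rfl hik
      · exact hd01
      · exact fun h => hd01 h.symm
      · exact absurd rfl hik
    have := re_mul_conj_lt_one_of_ne (hdn i) (hdn k) hne
    linarith [hmem.1]
  -- continuity of `H⁻¹` at `H (d i)`: a ball about `H (d i)` whose preimage misses `C k`
  have key : ∀ i k, i ≠ k → ∃ ε > (0 : ℝ), H.symm '' ball (H (d i)) ε ⊆ (C k)ᶜ := by
    intro i k hik
    have hopen : IsOpen (H.symm ⁻¹' (C k)ᶜ) := (hCcl k).isOpen_compl.preimage H.symm.continuous
    have hmem : H (d i) ∈ H.symm ⁻¹' (C k)ᶜ := by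
      show H.symm (H (d i)) ∉ C k
      rw [H.symm_apply_apply]; exact hdi i k hik
    obtain ⟨ε, hε, hball⟩ := Metric.isOpen_iff.1 hopen _ hmem
    exact ⟨ε, hε, by rintro _ ⟨z, hz, rfl⟩; exact hball hz⟩
  obtain ⟨ε₀, hε₀, h₀⟩ := key 0 1 (by decide)
  obtain ⟨ε₁, hε₁, h₁⟩ := key 1 0 (by decide)
  refine ⟨min ε₀ ε₁, lt_min hε₀ hε₁, fun τ i k hik => ?_⟩
  have hsub : H.symm '' ball (H (d i)) (min ε₀ ε₁) ⊆ (C k)ᶜ := by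
    fin_cases i <;> fin_cases k
    · exact absurd rfl hik
    · exact (image_mono (ball_subset_ball (min_le_left _ _))).trans h₀
    · exact (image_mono (ball_subset_ball (min_le_right _ _))).trans h₁
    · exact absurd rfl hik
  refine Set.disjoint_left.2 ?_
  rintro _ ⟨w, hw, rfl⟩ hz
  have hz' : H w ∈ ball (H (d i)) (min ε₀ ε₁) := by
    rw [mem_ball] at hz ⊢
    have : dist ((H.trans (Homeomorph.addRight (-τ))) w) (H (d i) - τ) = dist (H w) (H (d i)) := by
      simp [dist_eq_norm, sub_eq_add_neg]
    rwa [this] at hz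
  have : H.symm (H w) ∈ (C k)ᶜ := hsub ⟨H w, hz', rfl⟩
  rw [H.symm_apply_apply] at this
  exact this hw

end Summit.CriticalPhenomena.SAWScalingLimit.Theorems.ObservableToSLE.TypeLadder

end
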